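import Summits.BirchSwinnertonDyer.BirchSwinnertonDyer.Theorems.PrintCFramBottomClassIndexLawFiveLeFlipRungTwoMatrixFactorisation
import Literature.NumberTheory.EllipticCurves.HalfIntegralWeightFormsProofs
import HarnessLib

/-!
# Crux `PrintCFram.BottomClassIndexLawFiveLe` (stmt-BirchSwinnertonDyer-20372), line `eisenstein-resource-bdp-line` (registry v29 `stub_flipRungs.2`):
# THE 2-ADIC FLIPPED-CUSP RUNG, piece T6c/P1 — THE ODD-TRANSLATE FLIP IDENTITY at the cusp `a/M′` read through `W = γ₀·diag(64,1)`
# (cell `bsd-print-cfram`, width seat `bsd-line-cfram-p1-w7` g8; THEOREMS ONLY, `--supports` 20372 `--as helper`; BSD is not proved by any of this)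

HONEST FRAMING. Nothing here is a statement about BSD, elliptic curves or Bernoulli numbers; no registered stub is closed. This is piece P1 of
the kernel typing of (RungTwo⁶) (crux notes `Lines/eisenstein-resource-bdp-line-w7g8-T6.md` §5c; layer A `flipRungTwo_six_of_rungTwo`, p711746,
reduces v29's `stub_flipRungs.2` = (FlipRungTwo⁶) to it): the pointwise identity behind «the class cut `P_c g` read at the flipped cusp has
coefficients `w_c(n)·b(n)`». Data: `γ₀ = [[a, b],[M′, 64]] ∈ SL₂(ℤ)` (`64a − bM′ = 1`, `M′` odd; the cusp `a/M′`, `W = γ₀·diag(64, 1)`), the odd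
translates `z ↦ z + j/8`, and T6b's matrices `γ_j = [[8a + jM′, c_j + j + aj],[8M′, 8 + M′j]] ∈ Γ₀(4M′)` (`b + M′j² = 8c_j`,
`…FlipRungTwoMatrixFactorisation.translate_mul_W2_eq`: `τ_{j/8}·W = γ_j·[[64, −8j],[0, 64]]`).

* §1 `translate_flippedCusp_eq_smul` — ON `ℍ`: `(j/8) +ᵥ γ₀ • (64 • w) = γ_j • ((−j/8) +ᵥ w)`, and `denom γ_j ((−j/8) +ᵥ w) = 8(M′w + 1)` — the SAME
  automorphy base for every `j` (`denom_translate_eq`), so no half-integral cocycle ever appears.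
* §2 `apply_translate_flippedCusp` — for ANY `g : ℍ → ℂ` with `g(γ • z) = autFactor K N ψ γ z · g z` on `Γ₀(N)` (`apply_smul_eq_of_mem`, or
  `heckeFun_smul` for `g = G|U_4 = heckeFun K ψ 2 G`) and `γ_j ∈ Γ₀(N)`:
  `g((j/8) +ᵥ γ₀ • (64 • w)) = ψ(d_j)·(ε_{d_j}⁻¹·J(8M′ | d_j)·√(8(M′w + 1)))^K · g((−j/8) +ᵥ w)`, `d_j = 8 + M′j`.
* §3 `oddPart_flippedCusp_eq` — the weighted sum over `j ∈ {1,3,5,7}`: `Σ_j ω(j)·g((j/8) +ᵥ γ₀•(64•w)) = √(8(M′w+1))^K · Σ_j ω(j)·μ_j·g((−j/8) +ᵥ w)`,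
  `μ_j = ψ(d_j)(ε_{d_j}⁻¹ J(8M′|d_j))^K` (any weights `ω`, e.g. `ω(j) = ζ₈^{−cj}/8` of `Tunnell1983.classProj c`). With the `q`-expansion of `g`
  (`g((−j/8) +ᵥ w) = Σ_n b(n) ζ₈^{−nj} e(nw)`) the coefficient of `e(nw)` is `√(…)^K·(1/8)Σ_j ζ₈^{−(c+n)j} μ_j·b(n)` = T6a's
  `flipWeightSum_pattern_*` (`…FlipRungTwoGaussSums`, p711920) — sequel P1b.

No definitions, no named facts, no `sorry`. beyond-print theorem: NO (Shimura 1973 §1 bookkeeping).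
References: [Shimura1973HalfIntegral] §1 (`j(γ, z)`), Prop. 1.3–1.5; crux notes w7g8-T6 §1a, §5.
-/

set_option autoImplicit false
-- summit-side namespace `Summit.BirchSwinnertonDyer.BirchSwinnertonDyer.…` (single-conjunct summit, D-0017 layout)
set_option linter.dupNamespace false

noncomputable section

open UpperHalfPlane Complex
open scoped MatrixGroups NumberTheorySymbols Real
open Literature.NumberTheory.EllipticCurves.ModularForms (thetaEps thetaFactor shimuraSymbol autFactor shimuraSymbol_of_nonneg)

namespace Summit.BirchSwinnertonDyer.BirchSwinnertonDyer.Theorems.PrintCFram.FlipRung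

/-! ## §1 The odd translates of the flipped cusp are `γ_j`-images of translates of `w` -/

/-- The entries of T6b's `γ_j` from its defining identity `τ_{j/8}·W = γ_j·[[64, −8j],[0, 64]]`: `γ_j = [[8a + jM′, ·],[8M′, 8 + M′j]]` and
`8·(γ_j)₀₁ = b + 8j + j(8a + jM′)`. [folklore] -/
theorem entries_of_translate_mul_W2_eq {γ : SL(2, ℤ)} {M a b j : ℤ}
    (hmat : !![(8 : ℤ), j; 0, 8] * !![64 * a, b; 64 * M, 64] = (γ : Matrix (Fin 2) (Fin 2) ℤ) * !![64, -8 * j; 0, 64]) :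
    (γ 0 0 : ℤ) = 8 * a + j * M ∧ 8 * (γ 0 1 : ℤ) = b + 8 * j + j * (8 * a + j * M) ∧ (γ 1 0 : ℤ) = 8 * M ∧
      (γ 1 1 : ℤ) = 8 + M * j := by
  have e00 := congrArg (fun A : Matrix (Fin 2) (Fin 2) ℤ => A 0 0) hmat
  have e01 := congrArg (fun A : Matrix (Fin 2) (Fin 2) ℤ => A 0 1) hmat
  have e10 := congrArg (fun A : Matrix (Fin 2) (Fin 2) ℤ => A 1 0) hmat
  have e11 := congrArg (fun A : Matrix (Fin 2) (Fin 2) ℤ => A 1 1) hmat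
  simp only [Matrix.mul_apply, Fin.sum_univ_two, Matrix.of_apply, Matrix.cons_val', Matrix.cons_val_zero, Matrix.cons_val_one,
    Matrix.cons_val_fin_one] at e00 e01 e10 e11
  have h01 : (64 : ℤ) * (8 * (γ 0 1 : ℤ)) = 64 * (b + 8 * j + j * (8 * a + j * M)) := by
    linear_combination (-8) * e01 + (-j) * e00
  have h11 : (512 : ℤ) * (γ 1 1 : ℤ) = 512 * (8 + M * j) := by
    linear_combination (-8) * e11 + (-j) * e10
  refine ⟨by linarith, mul_left_cancel₀ (by norm_num) h01, by linarith, mul_left_cancel₀ (by norm_num) h11⟩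

/-- The automorphy base is the same for every `j`: `denom γ_j (w − j/8) = 8M′(w − j/8) + 8 + M′j = 8(M′w + 1)`. [folklore] -/
theorem denom_translate_eq (γ : SL(2, ℤ)) {M j : ℤ} (g10 : (γ 1 0 : ℤ) = 8 * M) (g11 : (γ 1 1 : ℤ) = 8 + M * j) (w : ℍ) :
    denom γ (((-(j : ℝ) / 8) +ᵥ w) : ℍ) = 8 * ((M : ℂ) * w + 1) := by
  rw [ModularGroup.denom_apply, g10, g11, coe_vadd]
  push_cast
  ring

/-- `M′w + 1 ≠ 0` for `w ∈ ℍ` (it is `denom γ_j (w − j/8)/8`). [folklore] -/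
theorem level_mul_add_one_ne_zero (γ : SL(2, ℤ)) {M j : ℤ} (g10 : (γ 1 0 : ℤ) = 8 * M) (g11 : (γ 1 1 : ℤ) = 8 + M * j) (w : ℍ) :
    (M : ℂ) * w + 1 ≠ 0 := by
  intro h
  have := denom_ne_zero γ (((-(j : ℝ) / 8) +ᵥ w) : ℍ)
  rw [denom_translate_eq γ g10 g11 w, h, mul_zero] at this
  exact this rfl

/-- **THE TRANSLATES OF THE FLIPPED CUSP.** For `γ₀ = [[a, b],[M′, 64]] ∈ SL₂(ℤ)` and T6b's `γ_j` (`τ_{j/8}·γ₀·diag(64,1) = γ_j·[[64, −8j],[0, 64]]`,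
`…FlipRungTwoMatrixFactorisation.exists_gamma0_translate_mul_W2_eq`), and every `w ∈ ℍ`: `(j/8) +ᵥ γ₀ • (64 • w) = γ_j • ((−j/8) +ᵥ w)`.
[cite: Shimura1973HalfIntegral, Prop. 1.5 (proof)] -/
theorem translate_flippedCusp_eq_smul (γ₀ γ : SL(2, ℤ)) {M a b j : ℤ}
    (h00 : (γ₀ 0 0 : ℤ) = a) (h01 : (γ₀ 0 1 : ℤ) = b) (h10 : (γ₀ 1 0 : ℤ) = M) (h11 : (γ₀ 1 1 : ℤ) = 64)
    (hmat : !![(8 : ℤ), j; 0, 8] * !![64 * a, b; 64 * M, 64] = (γ : Matrix (Fin 2) (Fin 2) ℤ) * !![64, -8 * j; 0, 64]) (w : ℍ) :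
    (((j : ℝ) / 8) +ᵥ γ₀ • ((⟨64, by norm_num⟩ : {x : ℝ // 0 < x}) • w) : ℍ) = γ • (((-(j : ℝ) / 8) +ᵥ w) : ℍ) := by
  obtain ⟨g00, g01, g10, g11⟩ := entries_of_translate_mul_W2_eq hmat
  have hw1 : (M : ℂ) * w + 1 ≠ 0 := level_mul_add_one_ne_zero γ g10 g11 w
  have h64 : (64 : ℂ) * ((M : ℂ) * w + 1) ≠ 0 := mul_ne_zero (by norm_num) hw1
  have h8 : (8 : ℂ) * ((M : ℂ) * w + 1) ≠ 0 := mul_ne_zero (by norm_num) hw1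
  have g01C : 8 * ((γ 0 1 : ℤ) : ℂ) = (b : ℂ) + 8 * j + j * (8 * a + j * M) := by exact_mod_cast g01
  -- the identity of complex numbers
  have key : ((j : ℂ) / 8) + ((a : ℂ) * ((64 : ℂ) * (w : ℂ)) + b) / ((M : ℂ) * ((64 : ℂ) * (w : ℂ)) + 64) =
      (((8 * a + j * M : ℤ) : ℂ) * (-(j : ℂ) / 8 + w) + ((γ 0 1 : ℤ) : ℂ)) /
        (((8 * M : ℤ) : ℂ) * (-(j : ℂ) / 8 + w) + ((8 + M * j : ℤ) : ℂ)) := by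
    push_cast
    rw [show (M : ℂ) * (64 * (w : ℂ)) + 64 = 64 * ((M : ℂ) * w + 1) by ring,
      show (8 * (M : ℂ)) * (-(j : ℂ) / 8 + w) + (8 + (M : ℂ) * j) = 8 * ((M : ℂ) * w + 1) by ring,
      div_add_div _ _ (by norm_num : (8 : ℂ) ≠ 0) h64, div_eq_div_iff (mul_ne_zero (by norm_num) h64) h8]
    linear_combination (-64 * ((M : ℂ) * (w : ℂ) + 1)) * g01C
  apply UpperHalfPlane.ext
  rw [coe_vadd, coe_specialLinearGroup_apply, coe_specialLinearGroup_apply, coe_pos_real_smul, coe_vadd, h00, h01, h10, h11,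
    g00, g10, g11]
  simp only [eq_intCast, Complex.real_smul, Complex.ofReal_div, Complex.ofReal_intCast, Complex.ofReal_ofNat, Complex.ofReal_neg]
  push_cast at key ⊢
  exact key

/-! ## §2 The value of a `Γ₀(N)`-automorphic `g` at the odd translates of the flipped cusp -/

/-- **`g` AT THE TRANSLATE `W(w) + j/8`.** For `g : ℍ → ℂ` with `g(γ • z) = autFactor K N ψ γ z·g(z)` on `Γ₀(N)` (a member of
`halfIntModularForms K N ψ`, `apply_smul_eq_of_mem`; or `heckeFun K ψ 2 G`, `heckeFun_smul`), `γ₀, γ_j` as in §1 with `γ_j ∈ Γ₀(N)` and `0 ≤ M′`: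
`g((j/8) +ᵥ γ₀•(64•w)) = ψ(d_j)·(ε_{d_j}⁻¹·J(8M′ | d_j)·√(8(M′w+1)))^K·g((−j/8) +ᵥ w)`, `d_j = 8 + M′j`. [cite: Shimura1973HalfIntegral, §1 (1.10)] -/
theorem apply_translate_flippedCusp {N K : ℕ} {ψ : DirichletCharacter ℂ N} {g : ℍ → ℂ}
    (hg : ∀ γ ∈ CongruenceSubgroup.Gamma0 N, ∀ z : ℍ, g (γ • z) = autFactor K N ψ γ z * g z)
    (γ₀ γ : SL(2, ℤ)) {M a b j : ℤ} (hM : 0 ≤ M)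
    (h00 : (γ₀ 0 0 : ℤ) = a) (h01 : (γ₀ 0 1 : ℤ) = b) (h10 : (γ₀ 1 0 : ℤ) = M) (h11 : (γ₀ 1 1 : ℤ) = 64)
    (hmat : !![(8 : ℤ), j; 0, 8] * !![64 * a, b; 64 * M, 64] = (γ : Matrix (Fin 2) (Fin 2) ℤ) * !![64, -8 * j; 0, 64])
    (hγ : γ ∈ CongruenceSubgroup.Gamma0 N) (w : ℍ) :
    g ((((j : ℝ) / 8) +ᵥ γ₀ • ((⟨64, by norm_num⟩ : {x : ℝ // 0 < x}) • w) : ℍ)) =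
      ψ (((8 + M * j : ℤ)) : ZMod N) *
        ((thetaEps (8 + M * j))⁻¹ * (J(8 * M | (8 + M * j).natAbs) : ℂ) * Complex.sqrt (8 * ((M : ℂ) * w + 1))) ^ K *
        g ((((-(j : ℝ) / 8) +ᵥ w) : ℍ)) := by
  obtain ⟨-, -, g10, g11⟩ := entries_of_translate_mul_W2_eq hmat
  rw [translate_flippedCusp_eq_smul γ₀ γ h00 h01 h10 h11 hmat w, hg γ hγ]
  have hden : ((γ 1 0 : ℤ) : ℂ) * (((((-(j : ℝ) / 8) +ᵥ w) : ℍ)) : ℂ) + ((γ 1 1 : ℤ) : ℂ) = 8 * ((M : ℂ) * w + 1) := by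
    rw [← ModularGroup.denom_apply]; exact denom_translate_eq γ g10 g11 w
  simp only [autFactor, thetaFactor]
  rw [hden, g10, g11, shimuraSymbol_of_nonneg (by positivity)]

/-! ## §3 The odd part of a translate average at the flipped cusp -/

/-- **THE ODD-TRANSLATE FLIP IDENTITY** (any weights `ω`; for the class cut `P_c`, `ω(j) = ζ₈^{−cj}/8`): with T6b's `γ_j` (`j ∈ {1,3,5,7}`), all in `Γ₀(N)`,
`Σ_{j∈{1,3,5,7}} ω(j)·g((j/8) +ᵥ γ₀•(64•w)) = √(8(M′w+1))^K · Σ_{j} ω(j)·ψ(d_j)·(ε_{d_j}⁻¹ J(8M′|d_j))^K · g((−j/8) +ᵥ w)`.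
[cite: Shimura1973HalfIntegral, §1 (1.10), Prop. 1.5] -/
theorem oddPart_flippedCusp_eq {N K : ℕ} {ψ : DirichletCharacter ℂ N} {g : ℍ → ℂ}
    (hg : ∀ γ ∈ CongruenceSubgroup.Gamma0 N, ∀ z : ℍ, g (γ • z) = autFactor K N ψ γ z * g z)
    (γ₀ : SL(2, ℤ)) {M a b : ℤ} (hM : 0 ≤ M)
    (h00 : (γ₀ 0 0 : ℤ) = a) (h01 : (γ₀ 0 1 : ℤ) = b) (h10 : (γ₀ 1 0 : ℤ) = M) (h11 : (γ₀ 1 1 : ℤ) = 64)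
    (γ : ℕ → SL(2, ℤ))
    (hγ : ∀ j ∈ ({1, 3, 5, 7} : Finset ℕ),
      !![(8 : ℤ), (j : ℤ); 0, 8] * !![64 * a, b; 64 * M, 64] = (γ j : Matrix (Fin 2) (Fin 2) ℤ) * !![64, -8 * (j : ℤ); 0, 64] ∧
        γ j ∈ CongruenceSubgroup.Gamma0 N)
    (ω : ℕ → ℂ) (w : ℍ) :
    ∑ j ∈ ({1, 3, 5, 7} : Finset ℕ), ω j * g ((((j : ℝ) / 8) +ᵥ γ₀ • ((⟨64, by norm_num⟩ : {x : ℝ // 0 < x}) • w) : ℍ)) =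
      Complex.sqrt (8 * ((M : ℂ) * w + 1)) ^ K *
        ∑ j ∈ ({1, 3, 5, 7} : Finset ℕ), ω j * (ψ (((8 + M * (j : ℤ) : ℤ)) : ZMod N) *
          ((thetaEps (8 + M * (j : ℤ)))⁻¹ * (J(8 * M | (8 + M * (j : ℤ)).natAbs) : ℂ)) ^ K) * g ((((-(j : ℝ) / 8) +ᵥ w) : ℍ)) := by
  rw [Finset.mul_sum]
  refine Finset.sum_congr rfl (fun j hj => ?_)
  obtain ⟨hmat, hγN⟩ := hγ j hj
  have h := apply_translate_flippedCusp hg γ₀ (γ j) hM h00 h01 h10 h11 hmat hγN w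
  rw [Int.cast_natCast] at h
  rw [h, mul_pow]
  ring

/-! ## §4 The coefficients: `q`-expansion of the odd part -/

/-- The parameter `e(z)` at the translate `w − j/8`: `e(n(w − j/8)) = e(−jn/8)·e(nw)`. [folklore] -/
theorem qParam_translate_pow (j : ℕ) (w : ℍ) (n : ℕ) :
    Function.Periodic.qParam 1 ((((-(j : ℝ) / 8) +ᵥ w) : ℍ) : ℂ) ^ n =
      cexp (-(2 * π * Complex.I * ((j * n : ℕ) : ℂ) / 8)) * Function.Periodic.qParam 1 (w : ℂ) ^ n := by
  simp only [Function.Periodic.qParam, coe_vadd]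
  push_cast
  rw [← Complex.exp_nat_mul, ← Complex.exp_nat_mul, ← Complex.exp_add]
  congr 1
  ring

/-- **THE `q`-EXPANSION OF THE ODD PART AT THE FLIPPED CUSP.** If `g(τ) = Σ_n b(n) e(nτ)` on `ℍ` (`hasSum_qCoeffs`, `hasSum_heckeFun`), then
`Σ_{j odd} ω(j)·g((j/8) +ᵥ γ₀•(64•w)) = Σ_n [√(8(M′w+1))^K · (Σ_{j odd} ω(j)·μ_j·e(−jn/8)) · b(n)] e(nw)`, `μ_j = ψ(d_j)(ε_{d_j}⁻¹J(8M′|d_j))^K`: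
the coefficient of `e(nw)` is the unit-weight `w(n)·b(n)` of the 2-adic flipped-cusp rung (the finite sum is evaluated by
`…FlipRungTwoGaussSums.flipWeightSum_pattern_*`). [cite: Shimura1973HalfIntegral, §1, Prop. 1.5] -/
theorem hasSum_oddPart_flippedCusp {N K : ℕ} {ψ : DirichletCharacter ℂ N} {g : ℍ → ℂ}
    (hg : ∀ γ ∈ CongruenceSubgroup.Gamma0 N, ∀ z : ℍ, g (γ • z) = autFactor K N ψ γ z * g z)
    (γ₀ : SL(2, ℤ)) {M a b : ℤ} (hM : 0 ≤ M)
    (h00 : (γ₀ 0 0 : ℤ) = a) (h01 : (γ₀ 0 1 : ℤ) = b) (h10 : (γ₀ 1 0 : ℤ) = M) (h11 : (γ₀ 1 1 : ℤ) = 64)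
    (γ : ℕ → SL(2, ℤ))
    (hγ : ∀ j ∈ ({1, 3, 5, 7} : Finset ℕ),
      !![(8 : ℤ), (j : ℤ); 0, 8] * !![64 * a, b; 64 * M, 64] = (γ j : Matrix (Fin 2) (Fin 2) ℤ) * !![64, -8 * (j : ℤ); 0, 64] ∧
        γ j ∈ CongruenceSubgroup.Gamma0 N)
    (ω : ℕ → ℂ) {b' : ℕ → ℂ} (hb : ∀ τ : ℍ, HasSum (fun n ↦ b' n * Function.Periodic.qParam 1 (τ : ℂ) ^ n) (g τ)) (w : ℍ) :
    HasSum (fun n : ℕ ↦ (Complex.sqrt (8 * ((M : ℂ) * w + 1)) ^ K *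
        ∑ j ∈ ({1, 3, 5, 7} : Finset ℕ), ω j * (ψ (((8 + M * (j : ℤ) : ℤ)) : ZMod N) *
          ((thetaEps (8 + M * (j : ℤ)))⁻¹ * (J(8 * M | (8 + M * (j : ℤ)).natAbs) : ℂ)) ^ K) *
            cexp (-(2 * π * Complex.I * ((j * n : ℕ) : ℂ) / 8))) * b' n * Function.Periodic.qParam 1 (w : ℂ) ^ n)
      (∑ j ∈ ({1, 3, 5, 7} : Finset ℕ), ω j * g ((((j : ℝ) / 8) +ᵥ γ₀ • ((⟨64, by norm_num⟩ : {x : ℝ // 0 < x}) • w) : ℍ))) := by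
  rw [oddPart_flippedCusp_eq hg γ₀ hM h00 h01 h10 h11 γ hγ ω w]
  have h : ∀ j ∈ ({1, 3, 5, 7} : Finset ℕ), HasSum (fun n : ℕ ↦ ω j * (ψ (((8 + M * (j : ℤ) : ℤ)) : ZMod N) *
      ((thetaEps (8 + M * (j : ℤ)))⁻¹ * (J(8 * M | (8 + M * (j : ℤ)).natAbs) : ℂ)) ^ K) *
        (b' n * (cexp (-(2 * π * Complex.I * ((j * n : ℕ) : ℂ) / 8)) * Function.Periodic.qParam 1 (w : ℂ) ^ n)))
      (ω j * (ψ (((8 + M * (j : ℤ) : ℤ)) : ZMod N) *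
        ((thetaEps (8 + M * (j : ℤ)))⁻¹ * (J(8 * M | (8 + M * (j : ℤ)).natAbs) : ℂ)) ^ K) * g ((((-(j : ℝ) / 8) +ᵥ w) : ℍ))) := by
    intro j _
    have hj := hb ((((-(j : ℝ) / 8) +ᵥ w) : ℍ))
    simp_rw [qParam_translate_pow j w] at hj
    exact hj.mul_left _
  have hs := (hasSum_sum h).mul_left (Complex.sqrt (8 * ((M : ℂ) * w + 1)) ^ K)
  refine hs.congr_fun (fun n => ?_)
  simp only [Finset.mul_sum, Finset.sum_mul]
  exact Finset.sum_congr rfl (fun j _ => by ring)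

/-! ## §5 Packaged with T6b: only `64a − M′b = 1` and the cusp matrix `γ₀` are needed -/

/-- **THE ODD PART AT THE FLIPPED CUSP, PACKAGED**: for `M′ : ℕ` with `64a − M′b = 1`, `γ₀ = [[a, b],[M′, 64]]`, `g` automorphic of weight `K/2`
on `Γ₀(4M′)` with character `ψ` and `q`-expansion `b`, the weighted odd-translate sum at `W(w)` has the `q`-expansion with coefficients
`√(8(M′w+1))^K · (Σ_{j∈{1,3,5,7}} ω(j)·ψ(8 + M′j)·(ε_{8+M′j}⁻¹ J(8M′ | 8 + M′j))^K·e(−jn/8)) · b(n)` (the matrices `γ_j ∈ Γ₀(4M′)` of T6b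
`exists_gamma0_translate_mul_W2_eq` are chosen inside the proof and do not appear). [cite: Shimura1973HalfIntegral, Prop. 1.5] -/
theorem hasSum_oddPart_flippedCusp_of_det {M : ℕ} {a b : ℤ} (hdet : 64 * a - (M : ℤ) * b = 1) (γ₀ : SL(2, ℤ))
    (h00 : (γ₀ 0 0 : ℤ) = a) (h01 : (γ₀ 0 1 : ℤ) = b) (h10 : (γ₀ 1 0 : ℤ) = M) (h11 : (γ₀ 1 1 : ℤ) = 64)
    {K : ℕ} {ψ : DirichletCharacter ℂ (4 * M)} {g : ℍ → ℂ}
    (hg : ∀ γ ∈ CongruenceSubgroup.Gamma0 (4 * M), ∀ z : ℍ, g (γ • z) = autFactor K (4 * M) ψ γ z * g z)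
    (ω : ℕ → ℂ) {b' : ℕ → ℂ} (hb : ∀ τ : ℍ, HasSum (fun n ↦ b' n * Function.Periodic.qParam 1 (τ : ℂ) ^ n) (g τ)) (w : ℍ) :
    HasSum (fun n : ℕ ↦ (Complex.sqrt (8 * ((M : ℂ) * w + 1)) ^ K *
        ∑ j ∈ ({1, 3, 5, 7} : Finset ℕ), ω j * (ψ (((8 + (M : ℤ) * (j : ℤ) : ℤ)) : ZMod (4 * M)) *
          ((thetaEps (8 + (M : ℤ) * (j : ℤ)))⁻¹ * (J(8 * (M : ℤ) | (8 + (M : ℤ) * (j : ℤ)).natAbs) : ℂ)) ^ K) *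
            cexp (-(2 * π * Complex.I * ((j * n : ℕ) : ℂ) / 8))) * b' n * Function.Periodic.qParam 1 (w : ℂ) ^ n)
      (∑ j ∈ ({1, 3, 5, 7} : Finset ℕ), ω j * g ((((j : ℝ) / 8) +ᵥ γ₀ • ((⟨64, by norm_num⟩ : {x : ℝ // 0 < x}) • w) : ℍ))) := by
  have H : ∀ j : ℕ, Odd (j : ℤ) → ∃ γ : SL(2, ℤ), γ ∈ CongruenceSubgroup.Gamma0 (4 * M) ∧
      !![(8 : ℤ), (j : ℤ); 0, 8] * !![64 * a, b; 64 * (M : ℤ), 64] = (γ : Matrix (Fin 2) (Fin 2) ℤ) * !![64, -8 * (j : ℤ); 0, 64] := by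
    intro j hj
    obtain ⟨γ, hγ, -, -, -, -, hmat⟩ := exists_gamma0_translate_mul_W2_eq hdet hj
    exact ⟨γ, hγ, hmat⟩
  choose! γ hγmem hγmat using H
  have hodd : ∀ j ∈ ({1, 3, 5, 7} : Finset ℕ), Odd (j : ℤ) := by
    intro j hj
    simp only [Finset.mem_insert, Finset.mem_singleton] at hj
    rcases hj with rfl | rfl | rfl | rfl <;> decide
  have hMC : ((M : ℤ) : ℂ) = (M : ℂ) := by norm_cast
  have h := hasSum_oddPart_flippedCusp hg γ₀ (M := (M : ℤ)) (Int.natCast_nonneg M) h00 h01 h10 h11 γ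
    (fun j hj => ⟨hγmat j (hodd j hj), hγmem j (hodd j hj)⟩) ω hb w
  rw [hMC] at h
  exact h

end Summit.BirchSwinnertonDyer.BirchSwinnertonDyer.Theorems.PrintCFram.FlipRung

end
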